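import Summits.AtomisticToContinuum.Crystallization.Theorems.PerronTransitivityTransitiveLocalLimitSuperBoundSparseOfK

/-!
# Crux `TransitiveLocalLimit` (stmt-AtomisticToContinuum-15100), line `registered`:
# L² homogeneity of site energies under copositivity (the gradient test), with a rate

The registered line reduces the crux to `stub_superBoundSparse` (no density of `θ`-super-bound sites
in Lennard-Jones ground states), whose conditional forms under the copositive crux K* =
`NoFractionalGain` (stmt-15098) are landed (`card_superBound_le_of_copositive`, one-sided, test weights
`c = 1 + t·1_S`).  This file records the sharper and two-sided content of the same hypothesis, which is
its FIRST-ORDER (KKT) condition at the interior point `c ≡ 1`: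

* `sum_sq_siteEnergy_sub_le_of_copositive` — if `Σ_{j≠i} |V_ij| ≤ C` at every site and the copositive
  inequality `2E·Σ cᵢ² ≤ Σᵢ Σ_{j≠i} cᵢcⱼV_ij` holds for all `c ≥ 0`, then
  `Σᵢ (𝓔ⁱ − 2E)² ≤ 2(C + 2|E|)·(E_LJ(x) − N·E)`.
  PROOF (gradient test): with `gᵢ = 𝓔ⁱ − 2E`, `A = C + 2|E|`, the weights `cᵢ = 1 − gᵢ/A` are
  non-negative (`𝓔ⁱ ≤ C`, `−2E ≤ 2|E|`); expanding, `Σ cᵢcⱼV_ij = 2E(x) − (2/A)Σ gᵢ𝓔ⁱ + (1/A²)Σ gᵢgⱼV_ij`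
  (symmetry of `V`), `Σ cᵢ² = N − (2/A)Σ gᵢ + (1/A²)Σ gᵢ²`, and `|Σ_{i≠j} gᵢgⱼV_ij| ≤ C·Σ gᵢ²` (AM–GM and
  the row bound), so K* reads `(2/A)Σgᵢ² ≤ 2(E(x) − NE) + (1/A²)(C + 2|E|)Σgᵢ²`, i.e. `Σgᵢ² ≤ 2A(E(x) − NE)`.
* `card_far_le_of_copositive` — Chebyshev: `#{i : θ < |𝓔ⁱ − 2E|} ≤ 2(C + 2|E|)(E(x) − N·E)/θ²`
  (both sides of `2E` at once, same rate as the landed one-sided bound).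
* `tendsto_avg_sq_siteEnergy_sub_of_copositive_groundStates`,
  `tendsto_density_far_of_copositive_groundStates` / `concentration_of_copositive_groundStates` (registered
  one-line form) — along Lennard-Jones ground states, K* on ground states
  (the weakest copositive hypothesis the line uses) gives `(1/N)Σᵢ(𝓔ⁱ − 2E*)² ≤ 2A(E(N)/N − E*) → 0`
  (`crysEnergyLimit`) and two-sided concentration in density at `2E*` — the conclusion of the landed
  stub 2 `stub_concentration_of_superBoundSparse`, here with a rate and without the pinned-average
  argument.

So, quantitatively: site-energy transitivity of ground-state local limits (the crux) is exactly the
stationarity of the copositive form at uniform occupation. All [folklore] given the hypothesis.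
-/

noncomputable section

namespace Summit.AtomisticToContinuum.Crystallization.Theorems.TransitiveLocalLimitBirth

open Filter Literature.MathematicalPhysics.StatisticalMechanics
open scoped BigOperators

/-- AM–GM for a weighted cross term: `a·b·v ≤ ((a² + b²)/2)·|v|`. [folklore] -/
theorem mul_mul_le_half_sq_add_sq_mul_abs (a b v : ℝ) :
    a * b * v ≤ (a ^ 2 + b ^ 2) / 2 * |v| := by
  have h1 : a * b * v ≤ |a * b| * |v| := by
    rw [← abs_mul]
    exact le_abs_self _
  have h2 : |a * b| ≤ (a ^ 2 + b ^ 2) / 2 := by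
    rw [abs_mul]
    nlinarith [sq_nonneg (|a| - |b|), sq_abs a, sq_abs b, abs_nonneg a, abs_nonneg b]
  exact h1.trans (mul_le_mul_of_nonneg_right h2 (abs_nonneg _))

/-- Row-sum (Schur) bound for the Lennard-Jones quadratic form of a configuration: if
`Σ_{j≠i} |V_ij| ≤ C` at every site then `Σᵢ Σ_{j≠i} gᵢ gⱼ V_ij ≤ C·Σᵢ gᵢ²` for all real weights `g`.
[folklore] -/
theorem sum_sum_mul_mul_lennardJones_le {N : ℕ} (x : Fin N → EuclideanSpace ℝ (Fin 3)) {C : ℝ}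
    (hCi : ∀ i, ∑ j ∈ Finset.univ.erase i, |lennardJones (dist (x i) (x j))| ≤ C)
    (g : Fin N → ℝ) :
    ∑ i, ∑ j ∈ Finset.univ.erase i, g i * g j * lennardJones (dist (x i) (x j)) ≤
      C * ∑ i, g i ^ 2 := by
  set V : Fin N → Fin N → ℝ := fun i j => lennardJones (dist (x i) (x j)) with hV
  have hVsymm : ∀ i j, |V i j| = |V j i| := fun i j => by simp only [hV, dist_comm]
  -- pointwise AM–GM, summed
  have h1 : ∑ i, ∑ j ∈ Finset.univ.erase i, g i * g j * V i j ≤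
      ∑ i, ∑ j ∈ Finset.univ.erase i, (g i ^ 2 / 2 * |V i j| + g j ^ 2 / 2 * |V i j|) :=
    Finset.sum_le_sum fun i _ => Finset.sum_le_sum fun j _ => by
      have := mul_mul_le_half_sq_add_sq_mul_abs (g i) (g j) (V i j)
      linarith
  -- the two halves
  have h2 : ∑ i, ∑ j ∈ Finset.univ.erase i, g i ^ 2 / 2 * |V i j| ≤ C / 2 * ∑ i, g i ^ 2 := by
    rw [Finset.mul_sum]
    refine Finset.sum_le_sum fun i _ => ?_
    rw [← Finset.mul_sum]
    have hg : 0 ≤ g i ^ 2 / 2 := by positivity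
    calc g i ^ 2 / 2 * ∑ j ∈ Finset.univ.erase i, |V i j| ≤ g i ^ 2 / 2 * C :=
          mul_le_mul_of_nonneg_left (hCi i) hg
      _ = C / 2 * g i ^ 2 := by ring
  have h3 : ∑ i, ∑ j ∈ Finset.univ.erase i, g j ^ 2 / 2 * |V i j| ≤ C / 2 * ∑ i, g i ^ 2 := by
    rw [sum_erase_comm (fun i j => g j ^ 2 / 2 * |V i j|), Finset.mul_sum]
    refine Finset.sum_le_sum fun j _ => ?_
    rw [← Finset.mul_sum]
    have hg : 0 ≤ g j ^ 2 / 2 := by positivity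
    have hrow : ∑ i ∈ Finset.univ.erase j, |V i j| ≤ C := by
      calc ∑ i ∈ Finset.univ.erase j, |V i j| = ∑ i ∈ Finset.univ.erase j, |V j i| :=
            Finset.sum_congr rfl fun i _ => hVsymm i j
        _ ≤ C := hCi j
    calc g j ^ 2 / 2 * ∑ i ∈ Finset.univ.erase j, |V i j| ≤ g j ^ 2 / 2 * C :=
          mul_le_mul_of_nonneg_left hrow hg
      _ = C / 2 * g j ^ 2 := by ring
  have h4 : ∑ i, ∑ j ∈ Finset.univ.erase i, (g i ^ 2 / 2 * |V i j| + g j ^ 2 / 2 * |V i j|) =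
      ∑ i, ∑ j ∈ Finset.univ.erase i, g i ^ 2 / 2 * |V i j| +
        ∑ i, ∑ j ∈ Finset.univ.erase i, g j ^ 2 / 2 * |V i j| := by
    rw [← Finset.sum_add_distrib]
    exact Finset.sum_congr rfl fun i _ => Finset.sum_add_distrib
  linarith [h1, h2, h3, h4]

/-- **L² homogeneity under copositivity (the gradient test, finite `N`).** Let `x` be a configuration
of `N` points of `ℝ³` whose absolute site sums are bounded by `C > 0` (`Σ_{j≠i} |V_ij| ≤ C` for all
`i`) and let `E` be a real number for which the copositive inequality `2E·Σcᵢ² ≤ Σᵢ Σ_{j≠i} cᵢcⱼV_ij`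
holds for all weights `c ≥ 0` on `x`.  Then `Σᵢ (𝓔ⁱ(x) − 2E)² ≤ 2(C + 2|E|)·(E_LJ(x) − N·E)`
(test with `cᵢ = 1 − (𝓔ⁱ − 2E)/(C + 2|E|) ≥ 0`). [folklore] -/
theorem sum_sq_siteEnergy_sub_le_of_copositive {N : ℕ} (x : Fin N → EuclideanSpace ℝ (Fin 3))
    {C E : ℝ} (hC : 0 < C)
    (hCi : ∀ i, ∑ j ∈ Finset.univ.erase i, |lennardJones (dist (x i) (x j))| ≤ C)
    (hK : ∀ c : Fin N → ℝ, (∀ i, 0 ≤ c i) → 2 * E * ∑ i, c i ^ 2 ≤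
      ∑ i, ∑ j ∈ Finset.univ.erase i, c i * c j * lennardJones (dist (x i) (x j))) :
    ∑ i, (siteEnergy lennardJones x i - 2 * E) ^ 2 ≤
      2 * (C + 2 * |E|) * (interactionEnergy lennardJones x - N * E) := by
  set V : Fin N → Fin N → ℝ := fun i j => lennardJones (dist (x i) (x j)) with hV
  set U : Fin N → ℝ := fun i => siteEnergy lennardJones x i with hUdef
  set A : ℝ := C + 2 * |E| with hA
  have hA0 : 0 < A := by positivity
  set s : ℝ := 1 / A with hs
  have hs0 : 0 < s := by positivity
  have hsA : s * A = 1 := by rw [hs]; field_simp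
  set g : Fin N → ℝ := fun i => U i - 2 * E with hg
  -- the site sums
  have hU : ∀ i, ∑ j ∈ Finset.univ.erase i, V i j = U i := fun i => rfl
  -- `U i ≤ C`, hence `g i ≤ A` and the weights `c = 1 - s g` are non-negative
  have hUle : ∀ i, U i ≤ C := fun i => by
    rw [← hU i]
    exact (Finset.sum_le_sum fun j _ => le_abs_self (V i j)).trans (hCi i)
  have hgA : ∀ i, g i ≤ A := fun i => by
    have h1 := hUle i
    have h2 := neg_abs_le E
    simp only [hg, hA]
    linarith
  set c : Fin N → ℝ := fun i => 1 - s * g i with hc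
  have hc0 : ∀ i, 0 ≤ c i := fun i => by
    have h1 : s * g i ≤ s * A := mul_le_mul_of_nonneg_left (hgA i) hs0.le
    simp only [hc]
    linarith
  have key := hK c hc0
  -- left-hand side: `Σ cᵢ² = N − 2s Σ gᵢ + s² Σ gᵢ²`
  have hL : ∑ i, c i ^ 2 = N - 2 * s * ∑ i, g i + s ^ 2 * ∑ i, g i ^ 2 := by
    have h1 : ∀ i, c i ^ 2 = 1 - 2 * s * g i + s ^ 2 * g i ^ 2 := fun i => by
      simp only [hc]
      ring
    simp_rw [h1]
    rw [Finset.sum_add_distrib, Finset.sum_sub_distrib, Finset.sum_const, Finset.card_univ,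
      Fintype.card_fin, ← Finset.mul_sum, ← Finset.mul_sum]
    simp
  -- right-hand side: expansion of `cᵢ cⱼ V_ij`
  have hR : ∑ i, ∑ j ∈ Finset.univ.erase i, c i * c j * V i j =
      ∑ i, ∑ j ∈ Finset.univ.erase i, V i j - s * ∑ i, g i * ∑ j ∈ Finset.univ.erase i, V i j -
        s * ∑ i, ∑ j ∈ Finset.univ.erase i, g j * V i j +
        s ^ 2 * ∑ i, ∑ j ∈ Finset.univ.erase i, g i * g j * V i j := by
    have h1 : ∀ i j, c i * c j * V i j =
        V i j - s * (g i * V i j) - s * (g j * V i j) + s ^ 2 * (g i * g j * V i j) := by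
      intro i j
      simp only [hc]
      ring
    simp_rw [h1, Finset.sum_add_distrib, Finset.sum_sub_distrib, Finset.mul_sum]
  -- T1 = 2 E(x)
  have hT1 : ∑ i, ∑ j ∈ Finset.univ.erase i, V i j = 2 * interactionEnergy lennardJones x := by
    rw [two_mul_interactionEnergy]
    rfl
  -- T2 = Σ g U
  have hT2 : ∑ i, g i * ∑ j ∈ Finset.univ.erase i, V i j = ∑ i, g i * U i :=
    Finset.sum_congr rfl fun i _ => by rw [hU i]
  -- T3 = T2 by symmetry
  have hT3 : ∑ i, ∑ j ∈ Finset.univ.erase i, g j * V i j = ∑ i, g i * U i := by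
    rw [sum_erase_comm (fun i j => g j * V i j)]
    refine Finset.sum_congr rfl fun j _ => ?_
    rw [← hU j, Finset.mul_sum]
    refine Finset.sum_congr rfl fun i _ => ?_
    simp only [hV, dist_comm]
  -- T4 ≤ C Σ g²
  have hT4 : ∑ i, ∑ j ∈ Finset.univ.erase i, g i * g j * V i j ≤ C * ∑ i, g i ^ 2 :=
    sum_sum_mul_mul_lennardJones_le x hCi g
  -- Σ g U = Σ g² + 2E Σ g
  have hgU : ∑ i, g i * U i = ∑ i, g i ^ 2 + 2 * E * ∑ i, g i := by
    rw [Finset.mul_sum, ← Finset.sum_add_distrib]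
    refine Finset.sum_congr rfl fun i _ => ?_
    simp only [hg]
    ring
  -- assemble
  set SG : ℝ := ∑ i, g i with hSG
  set SG2 : ℝ := ∑ i, g i ^ 2 with hSG2
  have hSG2nn : 0 ≤ SG2 := Finset.sum_nonneg fun i _ => sq_nonneg (g i)
  rw [hL, hR, hT1, hT2, hT3, hgU] at key
  -- key : 2E(N − 2s SG + s² SG2) ≤ 2E(x) − s(SG2 + 2E SG) − s(SG2 + 2E SG) + s² T4
  have h1 : 2 * s * SG2 ≤ 2 * (interactionEnergy lennardJones x - N * E) +
      s ^ 2 * (∑ i, ∑ j ∈ Finset.univ.erase i, g i * g j * V i j) - 2 * E * (s ^ 2 * SG2) := by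
    linarith
  have h2 : s ^ 2 * (∑ i, ∑ j ∈ Finset.univ.erase i, g i * g j * V i j) ≤ s ^ 2 * (C * SG2) :=
    mul_le_mul_of_nonneg_left hT4 (sq_nonneg s)
  have h3 : -(2 * E * (s ^ 2 * SG2)) ≤ 2 * |E| * (s ^ 2 * SG2) := by
    have : -E ≤ |E| := neg_le_abs E
    have hnn : 0 ≤ s ^ 2 * SG2 := by positivity
    nlinarith
  have h4 : 2 * s * SG2 ≤ 2 * (interactionEnergy lennardJones x - N * E) + s ^ 2 * A * SG2 := by
    have : s ^ 2 * (C * SG2) + 2 * |E| * (s ^ 2 * SG2) = s ^ 2 * A * SG2 := by rw [hA]; ring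
    linarith
  have h5 : s ^ 2 * A * SG2 = s * SG2 := by
    rw [sq, mul_assoc s s A, hsA, mul_one]
  have h6 : s * SG2 ≤ 2 * (interactionEnergy lennardJones x - N * E) := by linarith
  calc SG2 = A * (s * SG2) := by rw [← mul_assoc, mul_comm A s, hsA, one_mul]
    _ ≤ A * (2 * (interactionEnergy lennardJones x - N * E)) :=
        mul_le_mul_of_nonneg_left h6 hA0.le
    _ = 2 * (C + 2 * |E|) * (interactionEnergy lennardJones x - N * E) := by rw [hA]; ring

/-- **Two-sided concentration with a rate (finite `N`).** Under the hypotheses of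
`sum_sq_siteEnergy_sub_le_of_copositive`, for every `θ > 0` the sites whose site energy is `θ`-far
from `2E` (on either side) number at most `2(C + 2|E|)(E_LJ(x) − N·E)/θ²` (Chebyshev). [folklore] -/
theorem card_far_le_of_copositive {N : ℕ} (x : Fin N → EuclideanSpace ℝ (Fin 3)) {C E θ : ℝ}
    (hC : 0 < C) (hCi : ∀ i, ∑ j ∈ Finset.univ.erase i, |lennardJones (dist (x i) (x j))| ≤ C)
    (hθ : 0 < θ)
    (hK : ∀ c : Fin N → ℝ, (∀ i, 0 ≤ c i) → 2 * E * ∑ i, c i ^ 2 ≤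
      ∑ i, ∑ j ∈ Finset.univ.erase i, c i * c j * lennardJones (dist (x i) (x j))) :
    ((Finset.univ.filter fun i : Fin N => θ < |siteEnergy lennardJones x i - 2 * E|).card : ℝ) ≤
      2 * (C + 2 * |E|) / θ ^ 2 * (interactionEnergy lennardJones x - N * E) := by
  have hsq := sum_sq_siteEnergy_sub_le_of_copositive x hC hCi hK
  set F := Finset.univ.filter fun i : Fin N => θ < |siteEnergy lennardJones x i - 2 * E| with hF
  -- θ² · #F ≤ Σ_{i ∈ F} (𝓔ⁱ − 2E)² ≤ Σᵢ (𝓔ⁱ − 2E)²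
  have h1 : θ ^ 2 * (F.card : ℝ) ≤ ∑ i ∈ F, (siteEnergy lennardJones x i - 2 * E) ^ 2 := by
    rw [mul_comm, ← nsmul_eq_mul, ← Finset.sum_const]
    refine Finset.sum_le_sum fun i hi => ?_
    have hi' : θ < |siteEnergy lennardJones x i - 2 * E| := (Finset.mem_filter.1 hi).2
    have hθi : θ ^ 2 ≤ |siteEnergy lennardJones x i - 2 * E| ^ 2 :=
      pow_le_pow_left₀ hθ.le hi'.le 2
    rwa [sq_abs] at hθi
  have h2 : ∑ i ∈ F, (siteEnergy lennardJones x i - 2 * E) ^ 2 ≤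
      ∑ i, (siteEnergy lennardJones x i - 2 * E) ^ 2 :=
    Finset.sum_le_sum_of_subset_of_nonneg (Finset.filter_subset _ _) fun i _ _ => sq_nonneg _
  have hθ2 : 0 < θ ^ 2 := by positivity
  rw [div_mul_eq_mul_div, le_div_iff₀ hθ2]
  linarith

/-- **L² homogeneity along ground states, under K* on ground states.** If the copositive inequality
`2E*·Σ cᵢ² ≤ Σᵢ Σ_{j≠i} cᵢcⱼ V_LJ(|xᵢ − xⱼ|)` (`E* = ⨅_Q e_LJ(Q)`) holds on every Lennard-Jones ground state
of `ℝ³` for all weights `c ≥ 0`, then along every sequence of Lennard-Jones ground states the mean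
square deviation of the site energies from `2E*` tends to `0`:
`(1/N)·Σᵢ (𝓔ⁱ(x N) − 2E*)² ≤ 2(C_δ + 2|E*|)·(E(N)/N − E*) → 0` (`crysEnergyLimit`). [folklore] -/
theorem tendsto_avg_sq_siteEnergy_sub_of_copositive_groundStates
    (hK : ∀ (N : ℕ) (x : Fin N → EuclideanSpace ℝ (Fin 3)), IsGroundState lennardJones x →
      ∀ c : Fin N → ℝ, (∀ i, 0 ≤ c i) →
        2 * (⨅ Q : PeriodicConfiguration 3, Q.energyPerParticle lennardJones) * ∑ i, c i ^ 2 ≤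
          ∑ i, ∑ j ∈ Finset.univ.erase i, c i * c j * lennardJones (dist (x i) (x j)))
    (x : (N : ℕ) → (Fin N → EuclideanSpace ℝ (Fin 3))) (hx : ∀ N, IsGroundState lennardJones (x N)) :
    Tendsto (fun N : ℕ => (∑ i, (siteEnergy lennardJones (x N) i -
      2 * (⨅ Q : PeriodicConfiguration 3, Q.energyPerParticle lennardJones)) ^ 2 : ℝ) / N)
      atTop (nhds 0) := by
  set E : ℝ := ⨅ Q : PeriodicConfiguration 3, Q.energyPerParticle lennardJones with hE
  obtain ⟨δ, hδ, hδsep⟩ := LennardJonesMinimalDistance_holds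
  set C : ℝ := (δ⁻¹ ^ 6 / 12 + 1 / 6) * (250 * δ⁻¹ ^ 6) with hC
  have hC0 : 0 < C := by positivity
  set A : ℝ := C + 2 * |E| with hA
  -- finite-`N` bound on every ground state
  have hsum : ∀ N, ∑ i, (siteEnergy lennardJones (x N) i - 2 * E) ^ 2 ≤
      2 * A * (groundStateEnergy lennardJones 3 N - N * E) := fun N => by
    rw [← (hx N).2]
    refine sum_sq_siteEnergy_sub_le_of_copositive (x N) hC0 (fun i => ?_) fun c hc => ?_
    · exact sum_abs_lennardJones_erase_le (x N) hδ
        (fun k l hkl => hδsep N (x N) (hx N) k l hkl) i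
    · exact hK N (x N) (hx N) c hc
  -- the comparison sequence tends to `0`
  have hlim : Tendsto (fun N : ℕ => 2 * A * (groundStateEnergy lennardJones 3 N / N - E))
      atTop (nhds 0) := by
    have h := (Summit.AtomisticToContinuum.Crystallization.Theorems.ChargedEnergyGapNegative.crysEnergyLimit).sub_const E
    rw [sub_self] at h
    simpa using h.const_mul (2 * A)
  refine squeeze_zero' (Eventually.of_forall fun N =>
    div_nonneg (Finset.sum_nonneg fun i _ => sq_nonneg _) (Nat.cast_nonneg _)) ?_ hlim
  filter_upwards [eventually_ge_atTop 1] with N hN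
  have hN : (0 : ℝ) < N := by exact_mod_cast hN
  rw [div_le_iff₀ hN]
  calc ∑ i, (siteEnergy lennardJones (x N) i - 2 * E) ^ 2
      ≤ 2 * A * (groundStateEnergy lennardJones 3 N - N * E) := hsum N
    _ = 2 * A * (groundStateEnergy lennardJones 3 N / N - E) * N := by
        field_simp

/-- **Two-sided concentration along ground states, under K* on ground states** — the conclusion of the
landed stub 2 `stub_concentration_of_superBoundSparse` (density of sites `θ`-far from `2E*` tends to `0`),
obtained directly and with the rate `2(C_δ + 2|E*|)(E(N)/N − E*)/θ²`. [folklore] -/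
theorem tendsto_density_far_of_copositive_groundStates
    (hK : ∀ (N : ℕ) (x : Fin N → EuclideanSpace ℝ (Fin 3)), IsGroundState lennardJones x →
      ∀ c : Fin N → ℝ, (∀ i, 0 ≤ c i) →
        2 * (⨅ Q : PeriodicConfiguration 3, Q.energyPerParticle lennardJones) * ∑ i, c i ^ 2 ≤
          ∑ i, ∑ j ∈ Finset.univ.erase i, c i * c j * lennardJones (dist (x i) (x j)))
    (x : (N : ℕ) → (Fin N → EuclideanSpace ℝ (Fin 3))) (hx : ∀ N, IsGroundState lennardJones (x N))
    {θ : ℝ} (hθ : 0 < θ) :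
    Tendsto (fun N : ℕ => ((Finset.univ.filter fun i : Fin N =>
      θ < |siteEnergy lennardJones (x N) i -
        2 * (⨅ Q : PeriodicConfiguration 3, Q.energyPerParticle lennardJones)|).card : ℝ) / N)
      atTop (nhds 0) := by
  have hsq := tendsto_avg_sq_siteEnergy_sub_of_copositive_groundStates hK x hx
  set E : ℝ := ⨅ Q : PeriodicConfiguration 3, Q.energyPerParticle lennardJones with hE
  have hlim : Tendsto (fun N : ℕ => (1 / θ ^ 2) *
      ((∑ i, (siteEnergy lennardJones (x N) i - 2 * E) ^ 2 : ℝ) / N)) atTop (nhds 0) := by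
    have h := hsq.const_mul (1 / θ ^ 2)
    rw [mul_zero] at h
    exact h
  refine squeeze_zero' (Eventually.of_forall fun N => by positivity) ?_ hlim
  filter_upwards [eventually_ge_atTop 1] with N hN
  have hN : (0 : ℝ) < N := by exact_mod_cast hN
  have hθ2 : 0 < θ ^ 2 := by positivity
  set F := Finset.univ.filter fun i : Fin N => θ < |siteEnergy lennardJones (x N) i - 2 * E| with hF
  have h1 : θ ^ 2 * (F.card : ℝ) ≤ ∑ i ∈ F, (siteEnergy lennardJones (x N) i - 2 * E) ^ 2 := by
    rw [mul_comm, ← nsmul_eq_mul, ← Finset.sum_const]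
    refine Finset.sum_le_sum fun i hi => ?_
    have hi' : θ < |siteEnergy lennardJones (x N) i - 2 * E| := (Finset.mem_filter.1 hi).2
    have hθi : θ ^ 2 ≤ |siteEnergy lennardJones (x N) i - 2 * E| ^ 2 :=
      pow_le_pow_left₀ hθ.le hi'.le 2
    rwa [sq_abs] at hθi
  have h2 : ∑ i ∈ F, (siteEnergy lennardJones (x N) i - 2 * E) ^ 2 ≤
      ∑ i, (siteEnergy lennardJones (x N) i - 2 * E) ^ 2 :=
    Finset.sum_le_sum_of_subset_of_nonneg (Finset.filter_subset _ _) fun i _ _ => sq_nonneg _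
  rw [div_le_iff₀ hN]
  have h3 : (F.card : ℝ) ≤ (1 / θ ^ 2) * ∑ i, (siteEnergy lennardJones (x N) i - 2 * E) ^ 2 := by
    rw [one_div, ← div_eq_inv_mul, le_div_iff₀ hθ2, mul_comm]
    exact h1.trans h2
  calc (F.card : ℝ) ≤ (1 / θ ^ 2) * ∑ i, (siteEnergy lennardJones (x N) i - 2 * E) ^ 2 := h3
    _ = (1 / θ ^ 2) * ((∑ i, (siteEnergy lennardJones (x N) i - 2 * E) ^ 2 : ℝ) / N) * N := by
        field_simp

/-- **Registered form** (stub `concentration_of_copositive_groundStates` of the crux item, one-line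
fully qualified signature): K* on Lennard-Jones ground states ⇒ two-sided concentration in density of
the site energies at `2E*` along every sequence of ground states — the conclusion of stub 2 of the
registered line, reached directly by the gradient test (`tendsto_density_far_of_copositive_groundStates`).
[folklore] -/
theorem concentration_of_copositive_groundStates : (∀ (N : ℕ) (x : Fin N → EuclideanSpace ℝ (Fin 3)), Literature.MathematicalPhysics.StatisticalMechanics.IsGroundState Literature.MathematicalPhysics.StatisticalMechanics.lennardJones x → ∀ c : Fin N → ℝ, (∀ i, 0 ≤ c i) → 2 * (⨅ Q : Literature.MathematicalPhysics.StatisticalMechanics.PeriodicConfiguration 3, Q.energyPerParticle Literature.MathematicalPhysics.StatisticalMechanics.lennardJones) * ∑ i, c i ^ 2 ≤ ∑ i, ∑ j ∈ Finset.univ.erase i, c i * c j * Literature.MathematicalPhysics.StatisticalMechanics.lennardJones (dist (x i) (x j))) → ∀ x : (N : ℕ) → (Fin N → EuclideanSpace ℝ (Fin 3)), (∀ N, Literature.MathematicalPhysics.StatisticalMechanics.IsGroundState Literature.MathematicalPhysics.StatisticalMechanics.lennardJones (x N)) → ∀ θ : ℝ, 0 < θ → Filter.Tendsto (fun N : ℕ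 => ((Finset.univ.filter fun i : Fin N => θ < |Literature.MathematicalPhysics.StatisticalMechanics.siteEnergy Literature.MathematicalPhysics.StatisticalMechanics.lennardJones (x N) i - 2 * (⨅ Q : Literature.MathematicalPhysics.StatisticalMechanics.PeriodicConfiguration 3, Q.energyPerParticle Literature.MathematicalPhysics.StatisticalMechanics.lennardJones)|).card : ℝ) / N) Filter.atTop (nhds 0) :=
  fun hK x hx _θ hθ => tendsto_density_far_of_copositive_groundStates hK x hx hθ

end Summit.AtomisticToContinuum.Crystallization.Theorems.TransitiveLocalLimitBirth

end
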